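import Summits.Schanuel.Schanuel.Theorems.ZilberEacCancellingFibreExistence
import HarnessLib

/-!
# The axis `x₂ = r₀x₀ + c` (`0 < r₀(deg F₀ + 1) < 1`): parameters of the LOGARITHMIC-FIBRE regime

Zilber's Exponential-Algebraic Closedness, case ladder (host summit Schanuel, cell `pub-schanuel`,
seat 2, gen 15; HANDOFF O60 (i)).  For the explicit free family
`W = {x₂ = r₀x₀ + c, y₀ = x₀ + y₂F₀(y₂), y₁ = x₁ + y₂F₁(y₂)} ⊆ ℂ³ × ℂ³` (the AXIS `r₁ = 0` of the
real-plane family) the second fibre is DECOUPLED from the base: given `y₂`, the equation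
`e^{x₁} = x₁ + y₂F₁(y₂)` has a solution near `Log(a₁Y^{e₁}) + 2πik` for EVERY integer label `k` of
size `≍ m^β`, `β < r₀e₁` — the logarithmic branch.  The first fibre is slow:
`x₀ = Log(2πim) + 2πim + u₀`, `y₂ = Y_m e^{r₀u₀}`, `Y_m = e^{r₀(Log(2πim) + 2πim) + c}`,
`|Y_m| = e^{Re c}(2πm)^{r₀}`.  This file: the sizes and the SIX PARAMETER LIMITS of the rescaled
system (`ν₁ = Log(2πim)/(2πim)`, `μ₁ = 1/(2πim)` — gen 15 `tendsto_param_nu₁/mu₁` —,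
`θ = Y^{e₀}/(2πim) → 0` iff `r₀e₀ < 1`, `σ = Y⁻¹`, `q₂ = (a₁Y^{e₁})⁻¹`,
`q₁ = (Log(a₁Y^{e₁}) + 2πik)(a₁Y^{e₁})⁻¹ → 0` iff `β < r₀e₁`).

HONEST FRAMING: explicit members of an OPEN cell (`ECCell 3 2`); NOT Schanuel's conjecture;
EAC ⇏ SC.
-/

noncomputable section

open Complex Filter Topology

set_option linter.dupNamespace false

namespace Summit.Schanuel.Schanuel.Theorems

section AxisBlocks

/-- `‖Log z‖ ≤ |log‖z‖| + π` (a private copy of the lemma of `ZilberEacComplexMovingPolydisc`, to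
keep the import graph small). [folklore] -/
private theorem norm_log_le_abs_log_norm_add_pi' (z : ℂ) :
    ‖Complex.log z‖ ≤ |Real.log ‖z‖| + Real.pi := by
  refine (Complex.norm_le_abs_re_add_abs_im _).trans ?_
  rw [Complex.log_re, Complex.log_im]
  exact add_le_add le_rfl (Complex.abs_arg_le_pi z)

/-- `Re(r₀(Log(2πim) + 2πim) + c) = r₀ log(2πm) + Re c`. [folklore] -/
theorem re_axisExponent (r₀ : ℝ) (c : ℂ) (m : ℕ) :
    ((r₀ : ℂ) * (Complex.log (2 * Real.pi * I * (m : ℂ)) + 2 * Real.pi * I * (m : ℂ)) + c).re =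
      r₀ * Real.log (2 * Real.pi * m) + c.re := by
  rw [Complex.add_re, Complex.re_ofReal_mul, Complex.add_re, re_log_two_pi_I_mul_natCast,
    show (2 * Real.pi * I * (m : ℂ)) = 2 * Real.pi * I * ((m : ℝ) : ℂ) by norm_cast,
    re_two_pi_I_mul_ofReal, add_zero]

/-- `‖Y_m‖^e = exp(e(r₀ log 2π + Re c) + e r₀ log m)` for `m ≥ 1`,
`Y_m = e^{r₀(Log(2πim) + 2πim) + c}`. [folklore] -/
theorem norm_axisY_pow (r₀ : ℝ) (c : ℂ) {m : ℕ} (hm : 1 ≤ m) (e : ℕ) :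
    ‖exp ((r₀ : ℂ) * (Complex.log (2 * Real.pi * I * (m : ℂ)) + 2 * Real.pi * I * (m : ℂ)) + c)‖ ^ e =
      Real.exp ((e : ℝ) * (r₀ * Real.log (2 * Real.pi) + c.re) + (e : ℝ) * r₀ * Real.log m) := by
  have hmpos : (0 : ℝ) < m := by exact_mod_cast hm
  rw [Complex.norm_exp, re_axisExponent, ← Real.exp_nat_mul,
    Real.log_mul (by positivity) hmpos.ne']
  congr 1
  ring

end AxisBlocks

section AxisParams

variable {β : ℝ} {K : ℕ → ℝ} (hβ : 0 < β)
  (hK : ∀ m : ℕ, (m : ℝ) ^ β ≤ K m ∧ K m ≤ (m : ℝ) ^ β + 1) {r₀ : ℝ} (hr₀ : 0 < r₀) (c : ℂ)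

include hβ hK hr₀

/-- `σ_m = Y_m⁻¹ → 0`. [folklore] -/
theorem tendsto_axis_sigma :
    Tendsto (fun m : ℕ => (exp ((r₀ : ℂ) * (Complex.log (2 * Real.pi * I * (m : ℂ)) +
      2 * Real.pi * I * (m : ℂ)) + c))⁻¹) atTop (𝓝 0) := by
  rw [tendsto_zero_iff_norm_tendsto_zero]
  have h := tendsto_exp_affine_log hβ hK (-(r₀ * Real.log (2 * Real.pi) + c.re)) 0 (-r₀)
    (by linarith)
  refine h.congr' ?_
  filter_upwards [eventually_ge_atTop 1] with m hm
  rw [norm_inv, ← pow_one ‖exp _‖, norm_axisY_pow r₀ c hm 1, ← Real.exp_neg]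
  congr 1
  push_cast
  ring

omit hr₀ in
/-- `θ_m = Y_m^{e₀}/(2πim) → 0` when `r₀e₀ < 1`. [folklore] -/
theorem tendsto_axis_theta (e₀ : ℕ) (he : r₀ * e₀ < 1) :
    Tendsto (fun m : ℕ => (2 * Real.pi * I * (m : ℂ))⁻¹ * exp ((r₀ : ℂ) *
      (Complex.log (2 * Real.pi * I * (m : ℂ)) + 2 * Real.pi * I * (m : ℂ)) + c) ^ e₀) atTop (𝓝 0) := by
  rw [tendsto_zero_iff_norm_tendsto_zero]
  have h := tendsto_exp_affine_log hβ hK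
    ((e₀ : ℝ) * (r₀ * Real.log (2 * Real.pi) + c.re) - Real.log (2 * Real.pi)) 0 ((e₀ : ℝ) * r₀ - 1)
    (by nlinarith)
  refine h.congr' ?_
  filter_upwards [eventually_ge_atTop 1] with m hm
  have hmpos : (0 : ℝ) < m := by exact_mod_cast hm
  rw [norm_mul, norm_pow, norm_axisY_pow r₀ c hm e₀, norm_inv, norm_two_pi_I_mul_natCast,
    ← Real.exp_log (show (0 : ℝ) < 2 * Real.pi * m by positivity), ← Real.exp_neg, ← Real.exp_add,
    Real.log_mul (by positivity) hmpos.ne']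
  congr 1
  ring

/-- `q₂ = (a₁Y_m^{e₁})⁻¹ → 0` (`e₁ ≥ 1`). [folklore] -/
theorem tendsto_axis_q₂ {a₁ : ℂ} (ha₁ : a₁ ≠ 0) (e₁ : ℕ) (he₁ : 1 ≤ e₁) :
    Tendsto (fun m : ℕ => (a₁ * exp ((r₀ : ℂ) * (Complex.log (2 * Real.pi * I * (m : ℂ)) +
      2 * Real.pi * I * (m : ℂ)) + c) ^ e₁)⁻¹) atTop (𝓝 0) := by
  rw [tendsto_zero_iff_norm_tendsto_zero]
  have he₁R : (1 : ℝ) ≤ e₁ := by exact_mod_cast he₁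
  have h := tendsto_exp_affine_log hβ hK
    (-Real.log ‖a₁‖ - (e₁ : ℝ) * (r₀ * Real.log (2 * Real.pi) + c.re)) 0 (-((e₁ : ℝ) * r₀))
    (by nlinarith)
  refine h.congr' ?_
  filter_upwards [eventually_ge_atTop 1] with m hm
  rw [norm_inv, norm_mul, norm_pow, norm_axisY_pow r₀ c hm e₁,
    ← Real.exp_log (norm_pos_iff.2 ha₁), ← Real.exp_add, ← Real.exp_neg, Real.log_exp]
  congr 1
  ring

omit hβ hK in
/-- `‖Log(a₁Y_m^{e₁})‖ ≤ C + e₁r₀ log m` for `m ≥ 1`, `C = |log‖a₁‖| + e₁(r₀|log 2π| + |Re c|) + π`.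
[folklore] -/
theorem norm_log_axisTop_le {a₁ : ℂ} (ha₁ : a₁ ≠ 0) (e₁ : ℕ) {m : ℕ} (hm : 1 ≤ m) :
    ‖Complex.log (a₁ * exp ((r₀ : ℂ) * (Complex.log (2 * Real.pi * I * (m : ℂ)) +
      2 * Real.pi * I * (m : ℂ)) + c) ^ e₁)‖ ≤
      (|Real.log ‖a₁‖| + (e₁ : ℝ) * (r₀ * |Real.log (2 * Real.pi)| + |c.re|) + Real.pi) +
        (e₁ : ℝ) * r₀ * Real.log m := by
  refine (norm_log_le_abs_log_norm_add_pi' _).trans ?_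
  have hlogm : 0 ≤ Real.log m := Real.log_natCast_nonneg m
  rw [norm_mul, norm_pow, Real.log_mul (norm_ne_zero_iff.2 ha₁)
    (pow_ne_zero _ (norm_ne_zero_iff.2 (Complex.exp_ne_zero _))), norm_axisY_pow r₀ c hm e₁,
    Real.log_exp]
  have hnn : 0 ≤ (e₁ : ℝ) * r₀ * Real.log m := mul_nonneg (mul_nonneg (Nat.cast_nonneg _) hr₀.le) hlogm
  have h1 : |Real.log ‖a₁‖ + ((e₁ : ℝ) * (r₀ * Real.log (2 * Real.pi) + c.re) + (e₁ : ℝ) * r₀ * Real.log m)|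
      ≤ |Real.log ‖a₁‖| + ((e₁ : ℝ) * (r₀ * |Real.log (2 * Real.pi)| + |c.re|) + (e₁ : ℝ) * r₀ * Real.log m) := by
    refine (abs_add_le _ _).trans (add_le_add le_rfl ?_)
    refine (abs_add_le _ _).trans (add_le_add ?_ (le_of_eq (abs_of_nonneg hnn)))
    rw [abs_mul, abs_of_nonneg (by positivity : (0 : ℝ) ≤ e₁)]
    refine mul_le_mul_of_nonneg_left ((abs_add_le _ _).trans (add_le_add ?_ le_rfl)) (by positivity)
    rw [abs_mul, abs_of_pos hr₀]
  linarith

/-- `q₁ = (Log(a₁Y_m^{e₁}) + 2πiK_m)(a₁Y_m^{e₁})⁻¹ → 0` when `β < r₀e₁` (`K_m ∈ [m^β, m^β + 1]`).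
[folklore] -/
theorem tendsto_axis_q₁ {a₁ : ℂ} (ha₁ : a₁ ≠ 0) (e₁ : ℕ) (he₁ : 1 ≤ e₁) (hβ₁ : β < r₀ * e₁) :
    Tendsto (fun m : ℕ => (Complex.log (a₁ * exp ((r₀ : ℂ) * (Complex.log (2 * Real.pi * I * (m : ℂ)) +
        2 * Real.pi * I * (m : ℂ)) + c) ^ e₁) + 2 * Real.pi * I * (K m : ℂ)) *
      (a₁ * exp ((r₀ : ℂ) * (Complex.log (2 * Real.pi * I * (m : ℂ)) +
        2 * Real.pi * I * (m : ℂ)) + c) ^ e₁)⁻¹) atTop (𝓝 0) := by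
  set C₀ : ℝ := |Real.log ‖a₁‖| + (e₁ : ℝ) * (r₀ * |Real.log (2 * Real.pi)| + |c.re|) + Real.pi with hC₀
  set a : ℝ := -Real.log ‖a₁‖ - (e₁ : ℝ) * (r₀ * Real.log (2 * Real.pi) + c.re) with ha
  -- the two decaying majorants
  have hA : Tendsto (fun m : ℕ => Real.exp (a + 0 * Real.log (K m) + (-((e₁ : ℝ) * r₀)) * Real.log m))
      atTop (𝓝 0) := tendsto_exp_affine_log hβ hK a 0 _ (by nlinarith)
  have hB : Tendsto (fun m : ℕ => Real.exp (a + 1 * Real.log (K m) + (-((e₁ : ℝ) * r₀)) * Real.log m))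
      atTop (𝓝 0) := tendsto_exp_affine_log hβ hK a 1 _ (by linarith)
  have hlogK := tendsto_log_nat_div_label hβ (fun m => (hK m).1)
  have hsum : Tendsto (fun m : ℕ => (C₀ + 2 * Real.pi) * Real.exp (a + 0 * Real.log (K m) +
      (-((e₁ : ℝ) * r₀)) * Real.log m) + ((e₁ : ℝ) * r₀ + 2 * Real.pi) *
      Real.exp (a + 1 * Real.log (K m) + (-((e₁ : ℝ) * r₀)) * Real.log m)) atTop (𝓝 0) := by
    have := (hA.const_mul (C₀ + 2 * Real.pi)).add (hB.const_mul ((e₁ : ℝ) * r₀ + 2 * Real.pi))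
    simpa using this
  rw [tendsto_zero_iff_norm_tendsto_zero]
  refine squeeze_zero' (Eventually.of_forall fun m => norm_nonneg _) ?_ hsum
  filter_upwards [eventually_ge_atTop 1, hlogK.eventually (eventually_le_nhds one_pos)] with m hm hlm
  have hmpos : (0 : ℝ) < m := by exact_mod_cast hm
  have hK1 : 1 ≤ K m := one_le_of_rpow_le hβ (fun m => (hK m).1) hm
  have hKpos : 0 < K m := by linarith
  have hlogm : 0 ≤ Real.log m := Real.log_natCast_nonneg m
  have hlogmK : Real.log m ≤ K m := by
    have := (div_le_one hKpos).1 hlm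
    linarith
  -- the norm of the denominator
  have hT : ‖(a₁ * exp ((r₀ : ℂ) * (Complex.log (2 * Real.pi * I * (m : ℂ)) +
      2 * Real.pi * I * (m : ℂ)) + c) ^ e₁)⁻¹‖ = Real.exp (a + (-((e₁ : ℝ) * r₀)) * Real.log m) := by
    rw [norm_inv, norm_mul, norm_pow, norm_axisY_pow r₀ c hm e₁, ← Real.exp_log (norm_pos_iff.2 ha₁),
      ← Real.exp_add, ← Real.exp_neg, ha]
    congr 1
    ring
  have hnum : ‖Complex.log (a₁ * exp ((r₀ : ℂ) * (Complex.log (2 * Real.pi * I * (m : ℂ)) +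
      2 * Real.pi * I * (m : ℂ)) + c) ^ e₁) + 2 * Real.pi * I * (K m : ℂ)‖ ≤
      (C₀ + 2 * Real.pi) + ((e₁ : ℝ) * r₀ + 2 * Real.pi) * K m := by
    refine (norm_add_le _ _).trans ?_
    have h1 := norm_log_axisTop_le hr₀ c ha₁ e₁ hm
    have h2 : ‖2 * Real.pi * I * (K m : ℂ)‖ = 2 * Real.pi * K m := by
      rw [norm_mul, norm_mul, norm_mul, Complex.norm_I, mul_one, Complex.norm_real, Complex.norm_two,
        Real.norm_of_nonneg Real.pi_pos.le, Complex.norm_real, Real.norm_of_nonneg hKpos.le]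
    rw [h2]
    have h3 : (e₁ : ℝ) * r₀ * Real.log m ≤ (e₁ : ℝ) * r₀ * K m :=
      mul_le_mul_of_nonneg_left hlogmK (by positivity)
    nlinarith [Real.pi_pos]
  rw [norm_mul, hT]
  have hexp1 : Real.exp (a + 1 * Real.log (K m) + (-((e₁ : ℝ) * r₀)) * Real.log m) =
      K m * Real.exp (a + (-((e₁ : ℝ) * r₀)) * Real.log m) := by
    rw [one_mul, show a + Real.log (K m) + (-((e₁ : ℝ) * r₀)) * Real.log m =
      Real.log (K m) + (a + (-((e₁ : ℝ) * r₀)) * Real.log m) by ring, Real.exp_add, Real.exp_log hKpos]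
  rw [hexp1, zero_mul, add_zero]
  have hE : 0 ≤ Real.exp (a + (-((e₁ : ℝ) * r₀)) * Real.log m) := (Real.exp_pos _).le
  nlinarith

end AxisParams

end Summit.Schanuel.Schanuel.Theorems
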